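import Summits.ResolutionOfSingularities.ResolutionOfSingularities.Theorems.PAlterationPialtStubNormalizeRR
import Summits.ResolutionOfSingularities.ResolutionOfSingularities.Theorems.PAlterationPicoverToRadicialBottomReducedPullbackTransfer
import Summits.ResolutionOfSingularities.ResolutionOfSingularities.Theorems.PAlterationAssemblyReduction
import Literature.AlgebraicGeometry.Resolution.FiniteBirationalNormal
import Literature.AlgebraicGeometry.Resolution.PrincipalizationToResolution
import Literature.AlgebraicGeometry.Resolution.QuasiProjectiveResolution
import HarnessLib

/-!
# `Pialt` (crux stmt-ResolutionOfSingularities-0555), line `SketchIdeator2` / Card A: transfer of tameness, II — normalisation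

Helper file for the OPEN stub `stub_tameResolution` (`TameResolution_p`) of the lead's skeleton
`radicially-regular-endgame` (`--supports stmt-ResolutionOfSingularities-0555`; it does not close
the item). Step T3 of `Cruxes/Pialt/STUB-PLAN-stub_tameResolution.md`.

Vocabulary (INLINED in the statements): an integral scheme `Z` is **radicially regular (RR)**
if an integral regular `W` maps onto it by a finite, universally injective, surjective `W → Z`;
**locally RR (LRR)** if every point has an RR open neighbourhood; a **tame resolution** of `X`
is a proper birational `π : Z → X` with `Z` integral, normal and LRR.

* `lrr_of_rr` — RR implies LRR (neighbourhood `⊤`, witness composed with `Z ≅ ↑⊤`).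
* `lrr_normalization` (T3) — **the normalisation of an LRR variety is LRR.** For `Z` integral,
  locally of finite type over a field and LRR, every point `z̃` of `Z^ν` has an RR
  neighbourhood: with `U ∋ ν z̃` RR through `h : W → U` and `V := ν⁻¹ U`, the restriction
  `ν_U : V → U` is finite (E. Noether) and birational, so the reduced fibre product
  `P := (W ×_U V)_red` is integral, finite and birational over the NORMAL (regular) `W` — hence
  `P ≅ W` ("finite birational onto normal is an isomorphism", `isIso_of_isFinite_of_isBirational`)
  — and finite, universally injective, surjective over `V`; so `W ≅ P → V` exhibits `V` as RR.
  (This avoids comparing `V` with the normalisation of `U`.)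
* `tame_of_lrr_modification` — **an LRR modification can be normalised into a tame
  resolution**: if `π₀ : Z₀ → X` is proper birational with `Z₀` integral LRR and locally of
  finite type over a field, then `Z₀^ν → Z₀ → X` is a tame resolution of `X` (`Z₀^ν` is normal,
  finite birational over `Z₀`, and LRR by T3).
* `tame_of_rr_modification` — the same from an RR modification (the output shape of
  `stub_reordering`).
-/

set_option linter.dupNamespace false -- mandated namespace of this single-conjunct summit

noncomputable section

open CategoryTheory CategoryTheory.Limits AlgebraicGeometry TopologicalSpace
open Literature.AlgebraicGeometry.Resolution
open Scheme.IdealSheafData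

namespace Summit.ResolutionOfSingularities.ResolutionOfSingularities.Theorems.Pialt.RadiciallyRegular

/-! ## RR implies LRR -/

/-- An RR scheme is LRR: the neighbourhood `⊤` of any point is dominated by the RR witness
composed with the isomorphism `Z ⟶ ↑⊤`. [folklore] -/
theorem lrr_of_rr {Z : Scheme.{0}}
    (hZ : ∃ (W : Scheme.{0}) (h : W ⟶ Z), IsIntegral W ∧ Scheme.IsRegular W ∧ IsFinite h ∧
      UniversallyInjective h ∧ Function.Surjective h.base) :
    ∀ z : Z, ∃ U : Z.Opens, z ∈ U ∧ ∃ (W : Scheme.{0}) (h : W ⟶ (U : Scheme.{0})),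
      IsIntegral W ∧ Scheme.IsRegular W ∧ IsFinite h ∧ UniversallyInjective h ∧
        Function.Surjective h.base := by
  intro z
  obtain ⟨W, h, hW, hreg, hfin, hui, hsurj⟩ := hZ
  haveI := hfin
  haveI := hui
  haveI : Surjective h := ⟨hsurj⟩
  refine ⟨⊤, trivial, W, h ≫ (Scheme.topIso Z).inv, hW, hreg, inferInstance, ?_, Surjective.surj⟩
  exact MorphismProperty.comp_mem _ _ _ hui inferInstance

/-! ## The normalisation of an LRR variety is LRR (T3) -/

/-- **The normalisation of an LRR variety is LRR.** Let `Z` be integral, locally of finite type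
over a field `k`, and suppose every point of `Z` has an open neighbourhood `U` dominated by an
integral regular `W` through a finite, universally injective, surjective `h : W → U`. Then the
same holds for the normalisation `Z^ν`: for `z̃ ∈ Z^ν` take such a `U ∋ ν z̃` and `V := ν⁻¹U`;
`ν_U : V → U` is finite (E. Noether) and birational with `V` integral, so the reduced fibre
product `P := (W ×_U V)_red` is integral (`h` is a universal homeomorphism), finite and
birational over the regular — hence normal — `W`, therefore ISOMORPHIC to `W`
(`isIso_of_isFinite_of_isBirational`), while `P → V` is finite, universally injective and
surjective (base change of `h`). So `W ≅ P → V` exhibits `V ∋ z̃` as radicially regular.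
[folklore] -/
theorem lrr_normalization (k : Type) [Field k] (Z : Scheme.{0}) [IsIntegral Z]
    (f : Z ⟶ Spec (.of k)) [LocallyOfFiniteType f]
    (hL : ∀ z : Z, ∃ U : Z.Opens, z ∈ U ∧ ∃ (W : Scheme.{0}) (h : W ⟶ (U : Scheme.{0})),
      IsIntegral W ∧ Scheme.IsRegular W ∧ IsFinite h ∧ UniversallyInjective h ∧
        Function.Surjective h.base) :
    ∀ z : normalization Z, ∃ U : (normalization Z).Opens, z ∈ U ∧
      ∃ (W : Scheme.{0}) (h : W ⟶ (U : Scheme.{0})),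
        IsIntegral W ∧ Scheme.IsRegular W ∧ IsFinite h ∧ UniversallyInjective h ∧
          Function.Surjective h.base := by
  intro z
  -- the normalisation `ν : Z^ν → Z` is finite (E. Noether) and birational
  haveI : IsFinite (normalizationι Z) :=
    isFinite_normalizationι Z NoetherFiniteIntegralClosure_holds f
  have hbir : IsBirational (normalizationι Z) := isBirational_normalizationι Z f
  -- an RR neighbourhood `U ∋ ν z` and `V := ν⁻¹ U ∋ z`
  obtain ⟨U, hzU, W, h, hW, hreg, hfin, hui, hsurj⟩ := hL ((normalizationι Z).base z)
  have hzV : z ∈ (normalizationι Z) ⁻¹ᵁ U := hzU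
  haveI := hW
  haveI := hfin
  haveI := hui
  haveI : Surjective h := ⟨hsurj⟩
  haveI : Nonempty U := ⟨⟨(normalizationι Z).base z, hzU⟩⟩
  haveI : Nonempty ((normalizationι Z) ⁻¹ᵁ U : (normalization Z).Opens) := ⟨⟨z, hzV⟩⟩
  -- `ν_U : V → U` finite birational
  have hbirU : IsBirational (normalizationι Z ∣_ U) := hbir.morphismRestrict U
  -- the reduced fibre product `P := (W ×_U V)_red`, integral, finite birational over `W`
  set νU := normalizationι Z ∣_ U with hνU
  haveI hPint : IsIntegral (vanishingIdeal (⊤ : Closeds ↑(pullback h νU))).subscheme :=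
    isIntegral_reduced_pullback h νU
  have hbirP : IsBirational
      ((vanishingIdeal (⊤ : Closeds ↑(pullback h νU))).subschemeι ≫ pullback.fst h νU) :=
    stub_reducedPullbackTransfer W U _ h νU hbirU
  haveI hfinP : IsFinite
      ((vanishingIdeal (⊤ : Closeds ↑(pullback h νU))).subschemeι ≫ pullback.fst h νU) :=
    inferInstance
  -- `W` is regular, hence normal, so `P ≅ W`
  have hWn : ∀ w : W, IsIntegrallyClosed (W.presheaf.stalk w) := fun w =>
    haveI := hreg w
    isIntegrallyClosed_of_isRegularLocalRing (W.presheaf.stalk w)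
  haveI hiso : IsIso
      ((vanishingIdeal (⊤ : Closeds ↑(pullback h νU))).subschemeι ≫ pullback.fst h νU) :=
    isIso_of_isFinite_of_isBirational _ hWn hbirP
  -- `P → V` is finite, universally injective and surjective
  haveI hfin₂ : IsFinite
      ((vanishingIdeal (⊤ : Closeds ↑(pullback h νU))).subschemeι ≫ pullback.snd h νU) :=
    isFinite_reduced_pullback_snd h νU
  have hui₂ : UniversallyInjective
      ((vanishingIdeal (⊤ : Closeds ↑(pullback h νU))).subschemeι ≫ pullback.snd h νU) :=
    universallyInjective_reduced_pullback_snd h νU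
  haveI hsurj₂ : Surjective
      ((vanishingIdeal (⊤ : Closeds ↑(pullback h νU))).subschemeι ≫ pullback.snd h νU) :=
    surjective_reduced_pullback_snd h νU
  -- `W ≅ P → V` exhibits `V` as RR
  refine ⟨(normalizationι Z) ⁻¹ᵁ U, hzV, W,
    inv ((vanishingIdeal (⊤ : Closeds ↑(pullback h νU))).subschemeι ≫ pullback.fst h νU) ≫
      ((vanishingIdeal (⊤ : Closeds ↑(pullback h νU))).subschemeι ≫ pullback.snd h νU),
    hW, hreg, inferInstance, ?_, Surjective.surj⟩
  exact MorphismProperty.comp_mem _ _ _ inferInstance hui₂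

/-! ## Normalising an LRR modification gives a tame resolution -/

/-- **An LRR modification can be normalised into a tame resolution.** If `π₀ : Z₀ → X` is proper
and birational with `Z₀` integral, locally of finite type over a field `k` and LRR, then
`π := ν ≫ π₀ : Z₀^ν → X` is a tame resolution of `X`: the normalisation `ν` is finite
(E. Noether), hence proper, and birational; `Z₀^ν` is integral and normal
(`isIntegrallyClosed_stalk_normalization`) and LRR (`lrr_normalization`). [folklore] -/
theorem tame_of_lrr_modification (k : Type) [Field k] (X Z₀ : Scheme.{0}) [IsIntegral Z₀]
    (f₀ : Z₀ ⟶ Spec (.of k)) [LocallyOfFiniteType f₀] (π₀ : Z₀ ⟶ X) [IsProper π₀]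
    (hπ₀ : IsBirational π₀)
    (hL : ∀ z : Z₀, ∃ U : Z₀.Opens, z ∈ U ∧ ∃ (W : Scheme.{0}) (h : W ⟶ (U : Scheme.{0})),
      IsIntegral W ∧ Scheme.IsRegular W ∧ IsFinite h ∧ UniversallyInjective h ∧
        Function.Surjective h.base) :
    ∃ (Z : Scheme.{0}) (π : Z ⟶ X), IsProper π ∧ IsBirational π ∧ IsIntegral Z ∧
      (∀ z : Z, IsIntegrallyClosed (Z.presheaf.stalk z)) ∧
      ∀ z : Z, ∃ U : Z.Opens, z ∈ U ∧ ∃ (W : Scheme.{0}) (h : W ⟶ (U : Scheme.{0})),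
        IsIntegral W ∧ Scheme.IsRegular W ∧ IsFinite h ∧ UniversallyInjective h ∧
          Function.Surjective h.base := by
  haveI : IsFinite (normalizationι Z₀) :=
    isFinite_normalizationι Z₀ NoetherFiniteIntegralClosure_holds f₀
  exact ⟨normalization Z₀, normalizationι Z₀ ≫ π₀, inferInstance,
    (isBirational_normalizationι Z₀ f₀).comp hπ₀, inferInstance,
    isIntegrallyClosed_stalk_normalization Z₀, lrr_normalization k Z₀ f₀ hL⟩

/-- **An RR modification can be normalised into a tame resolution** (the output shape of the
reordering lemma `stub_reordering`): `lrr_of_rr` + `tame_of_lrr_modification`. [folklore] -/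
theorem tame_of_rr_modification (k : Type) [Field k] (X Z₀ : Scheme.{0}) [IsIntegral Z₀]
    (f₀ : Z₀ ⟶ Spec (.of k)) [LocallyOfFiniteType f₀] (π₀ : Z₀ ⟶ X) [IsProper π₀]
    (hπ₀ : IsBirational π₀)
    (hR : ∃ (W : Scheme.{0}) (h : W ⟶ Z₀), IsIntegral W ∧ Scheme.IsRegular W ∧ IsFinite h ∧
      UniversallyInjective h ∧ Function.Surjective h.base) :
    ∃ (Z : Scheme.{0}) (π : Z ⟶ X), IsProper π ∧ IsBirational π ∧ IsIntegral Z ∧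
      (∀ z : Z, IsIntegrallyClosed (Z.presheaf.stalk z)) ∧
      ∀ z : Z, ∃ U : Z.Opens, z ∈ U ∧ ∃ (W : Scheme.{0}) (h : W ⟶ (U : Scheme.{0})),
        IsIntegral W ∧ Scheme.IsRegular W ∧ IsFinite h ∧ UniversallyInjective h ∧
          Function.Surjective h.base :=
  tame_of_lrr_modification k X Z₀ f₀ π₀ hπ₀ (lrr_of_rr hR)

end Summit.ResolutionOfSingularities.ResolutionOfSingularities.Theorems.Pialt.RadiciallyRegular

end
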